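import Literature.NumberTheory.Automorphic.UnitaryThreeUnipotentConjugacy   -- ★ `B₀_apply_conj_sub_one_mulVec`, corner unipotents, conjugation bookkeeping (F0P3a-p08 (g16∕g17))
import HarnessLib

/-!
# The two transvection classes of the unramified `U(3)` are separated by the VALUATION of the invariant `B₀(x, (y − 1)x)` (Rogawski 1990, §3.9; RANK organ, algebra half)

Topic `NumberTheory/Automorphic`; namespace `Literature.NumberTheory.Automorphic.UnitaryGroup`.  THEOREMS ONLY (no definition, no instance, no notation, no named fact,
no `sorry`).  Cell `pub/hodgecm-mathlib` (D-0151), crux H413 = `stmt-HodgeConjecture-24833`, line «N6nsGerm», residue `stub_N6nsS3id`, road «S3-tree», organ ‹RANK› «ORBIT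
SEPARATION AT LEVEL 2» (architect A-p16 (g29) A-84 (2) ∕ A-87 (1), holder F0P3a-p08 (g17), second B-p14 (g36); census `F0/P3a/F0P3a-p08/g17/rank/CENSUS-RANK-…md` 9e6f031a §3).
THE ALGEBRA HALF of the incidence table «unipotent orbit meets level-2 reference piece»: the pieces `T⁺ = {y ∈ K | ȳ a transvection}` and `T⁻ = {y ∈ K(1) | (y − 1)∕ϖ residually a
non-zero square-zero}` detect an invariant value `B₀(x, (y − 1)x)` of valuation `1` (a unit) resp. EXACTLY `v(ϖ)`; this file proves, over any valued field `K` with an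
involution `σ` preserving the valuation, that a conjugate of `n(t)` has invariant values of valuation `v(t)·(square)` ONLY (★ `B₀_apply_conj_sub_one_mulVec`: the value set is
`t·N(K)`), and that `(square) ≠ v(ϖ)·(square)` when `v(ϖ) = exp(−1)` — so the UNIT-parameter class never shows a value of valuation `exp(−1)` and the `ϖ`-parameter class never
shows a unit value: **`T⁺ ∩ tv⁻ = ∅` and `T⁻ ∩ tv⁺ = ∅`**, the two parity zeros of the lower-triangular RANK matrix.  Written by F0P3a-p08 (g17).  HONEST LABEL: HC_CM is proved only
modulo the printed citations (the 2 remaining named inputs hLiu418, h413) until rung 0 closes; elementary valued linear algebra, no measures.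

* §1 `sq_ne_exp_neg_one_mul_sq` — in `ℤᵐ⁰`: `x² ≠ exp(−1)·y²` for `y ≠ 0` (a square has even exponent); `v_norm_eq_sq` — `v(σz·z) = v(z)²` when `v ∘ σ = v`.
* §2 `v_B₀_conj_cornerUnipotent_sub_one_mulVec` — for `y = k n(t) k⁻¹` (`k ∈ U(σ, J₀)`): `v(B₀(x, (y−1)x)) = v(t)·v(a)²`, `a = (k⁻¹x)₂`; `B₀_single_two_cornerUnipotent` — the
  witness `B₀(e₂, (n(t)−1)e₂) = t`.
* §3 **`v_B₀_conj_ne_one_of_v_eq_exp_neg_one`** — if `v(t) = exp(−1)` (the class `tv⁻`, e.g. `t = ϖδ`), NO invariant value of a conjugate is a unit;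
  **`v_B₀_conj_ne_exp_neg_one_of_v_eq_one`** — if `v(t) = 1` (the class `tv⁺`, `t = δ`), NO invariant value of a conjugate has valuation `exp(−1)`;
  `v_B₀_cornerUnipotent_single_two` — the diagonal witnesses `v(B₀(e₂,(n(t)−1)e₂)) = v(t)`.
* §4 `conj_cornerUnipotent_sub_one_mul_self` — conjugates of `n(t)` are square-zero: `(y − 1)² = 0` (so the residually-REGULAR piece `R` misses both transvection classes and `1`,
  ★ `conj_sub_one_mul_self_eq_zero_iff`).

## References
* [Rogawski1990] J. D. Rogawski, *Automorphic Representations of Unitary Groups in Three Variables*, Ann. of Math. Stud. 123 (1990): §3.9 p. 32 («the conjugacy class of `u` is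
  determined by `t mod NE^*`»), §8.1 pp. 112–114 (unipotent orbital integrals ∕ germs, where the classes are separated by `K`-level functions).
* [HarishChandra1999AdmissibleDistributions] Harish-Chandra, *Admissible Invariant Distributions on Reductive p-adic Groups*, AMS ULS 16 (1999), §3.1 p. 17 (unipotent orbits).
-/

set_option autoImplicit false

open Matrix
open scoped Valued WithZero

namespace Literature.NumberTheory.Automorphic.UnitaryGroup

open Literature.NumberTheory.Automorphic.HermitianLattice

/-! ## §1 Parity in the value group -/

/-- **A square is never `exp(−1)` times a non-zero square in `ℤᵐ⁰`** (exponents: `2m ≠ 2n − 1`). [cite: Rogawski1990, §3.9 p. 32] -/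
theorem sq_ne_exp_neg_one_mul_sq {x y : ℤᵐ⁰} (hy : y ≠ 0) : x ^ 2 ≠ WithZero.exp (-1 : ℤ) * y ^ 2 := by
  intro h
  by_cases hx : x = 0
  · rw [hx, zero_pow two_ne_zero] at h
    exact (mul_ne_zero WithZero.exp_ne_zero (pow_ne_zero 2 hy)) h.symm
  · rw [← WithZero.exp_log hx, ← WithZero.exp_log hy, ← WithZero.exp_nsmul, ← WithZero.exp_nsmul, ← WithZero.exp_add] at h
    have h' := WithZero.exp_injective h
    rw [two_nsmul, two_nsmul] at h'
    omega

variable {K : Type*} [Field K] [Valued K ℤᵐ⁰] (σ : K →+* K)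

/-- `v(σz · z) = v(z)²` when `σ` preserves the valuation. [cite: Rogawski1990, §3.9 p. 32] -/
theorem v_norm_eq_sq (hvσ : ∀ a, Valued.v (σ a) = Valued.v a) (z : K) : Valued.v (σ z * z) = Valued.v z ^ 2 := by
  rw [map_mul, hvσ, sq]

/-! ## §2 The valuation of the invariant value of a transvection conjugate -/

/-- **`v(B₀(x, (y − 1)x)) = v(t) · v(a)²`** for `y = k n(t) k⁻¹`, `k ∈ U(σ, J₀)`, `a = (k⁻¹x)₂` (★ `B₀_apply_conj_sub_one_mulVec`: the value is `t·σa·a`).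
[cite: Rogawski1990, §3.9 p. 32] -/
theorem v_B₀_conj_cornerUnipotent_sub_one_mulVec (hvσ : ∀ a, Valued.v (σ a) = Valued.v a) {t : K} {u k : GL (Fin 3) K}
    (hu : (u : Matrix (Fin 3) (Fin 3) K) = !![1, 0, t; 0, 1, 0; 0, 0, 1]) (hk : k ∈ unitaryGroupOfForm σ ((StdForm.antidiagonal 3).over K)) (x : Fin 3 → K) :
    Valued.v (B₀ σ 3 x ((((k * u * k⁻¹ : GL (Fin 3) K) : Matrix (Fin 3) (Fin 3) K) - 1) *ᵥ x)) =
      Valued.v t * Valued.v ((((k⁻¹ : GL (Fin 3) K) : Matrix (Fin 3) (Fin 3) K) *ᵥ x) 2) ^ 2 := by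
  rw [B₀_apply_conj_sub_one_mulVec σ hu hk x, map_mul, v_norm_eq_sq σ hvσ]

omit [Valued K ℤᵐ⁰] in
/-- **The diagonal witness**: `B₀(e₂, (n(t) − 1)e₂) = t` (take `k = 1`, `x = e₂`, `a = 1`). [cite: Rogawski1990, §3.9 p. 32] -/
theorem B₀_single_two_cornerUnipotent {t : K} {u : GL (Fin 3) K} (hu : (u : Matrix (Fin 3) (Fin 3) K) = !![1, 0, t; 0, 1, 0; 0, 0, 1]) :
    B₀ σ 3 (Pi.single 2 1) (((u : Matrix (Fin 3) (Fin 3) K) - 1) *ᵥ Pi.single 2 1) = t := by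
  have h := B₀_apply_conj_sub_one_mulVec σ hu (one_mem (unitaryGroupOfForm σ ((StdForm.antidiagonal 3).over K))) (Pi.single 2 1)
  rw [one_mul, inv_one, mul_one, Units.val_one, Matrix.one_mulVec] at h
  rw [h]
  simp

/-- `v(B₀(e₂, (n(t) − 1)e₂)) = v(t)`: the class representative itself shows an invariant value of valuation `v(t)` (`n(δ) ∈ T⁺`, `n(ϖδ) ∈ T⁻` in the census' table).
[cite: Rogawski1990, §3.9 p. 32] -/
theorem v_B₀_cornerUnipotent_single_two {t : K} {u : GL (Fin 3) K} (hu : (u : Matrix (Fin 3) (Fin 3) K) = !![1, 0, t; 0, 1, 0; 0, 0, 1]) :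
    Valued.v (B₀ σ 3 (Pi.single 2 1) (((u : Matrix (Fin 3) (Fin 3) K) - 1) *ᵥ Pi.single 2 1)) = Valued.v t := by
  rw [B₀_single_two_cornerUnipotent σ hu]

/-! ## §3 The parity separation of the two transvection classes -/

/-- **`T⁺ ∩ tv⁻ = ∅` (algebra form): a conjugate of `n(t)` with `v(t) = exp(−1)` has NO invariant value of valuation `1`** — `v(B₀(x,(y−1)x)) = exp(−1)·v(a)² ≠ 1 = 1²`.  So an
element of the `ϖ`-parameter transvection class is never residually a transvection. [cite: Rogawski1990, §3.9 p. 32] -/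
theorem v_B₀_conj_ne_one_of_v_eq_exp_neg_one (hvσ : ∀ a, Valued.v (σ a) = Valued.v a) {t : K} (ht : Valued.v t = WithZero.exp (-1 : ℤ)) {u k : GL (Fin 3) K}
    (hu : (u : Matrix (Fin 3) (Fin 3) K) = !![1, 0, t; 0, 1, 0; 0, 0, 1]) (hk : k ∈ unitaryGroupOfForm σ ((StdForm.antidiagonal 3).over K)) (x : Fin 3 → K) :
    Valued.v (B₀ σ 3 x ((((k * u * k⁻¹ : GL (Fin 3) K) : Matrix (Fin 3) (Fin 3) K) - 1) *ᵥ x)) ≠ 1 := by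
  rw [v_B₀_conj_cornerUnipotent_sub_one_mulVec σ hvσ hu hk x, ht]
  intro h
  set a := Valued.v ((((k⁻¹ : GL (Fin 3) K) : Matrix (Fin 3) (Fin 3) K) *ᵥ x) 2) with ha
  have ha0 : a ≠ 0 := by
    intro h0
    rw [h0, zero_pow two_ne_zero, mul_zero] at h
    exact zero_ne_one h
  exact sq_ne_exp_neg_one_mul_sq ha0 (by rw [one_pow, h])

/-- **`T⁻ ∩ tv⁺ = ∅` (algebra form): a conjugate of `n(t)` with `v(t) = 1` has NO invariant value of valuation `exp(−1)`** — `v(B₀(x,(y−1)x)) = v(a)² ≠ exp(−1)·1²`.  So an element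
of the UNIT-parameter transvection class never has a level-one leading term that is residually a non-zero square-zero. [cite: Rogawski1990, §3.9 p. 32] -/
theorem v_B₀_conj_ne_exp_neg_one_of_v_eq_one (hvσ : ∀ a, Valued.v (σ a) = Valued.v a) {t : K} (ht : Valued.v t = 1) {u k : GL (Fin 3) K}
    (hu : (u : Matrix (Fin 3) (Fin 3) K) = !![1, 0, t; 0, 1, 0; 0, 0, 1]) (hk : k ∈ unitaryGroupOfForm σ ((StdForm.antidiagonal 3).over K)) (x : Fin 3 → K) :
    Valued.v (B₀ σ 3 x ((((k * u * k⁻¹ : GL (Fin 3) K) : Matrix (Fin 3) (Fin 3) K) - 1) *ᵥ x)) ≠ WithZero.exp (-1 : ℤ) := by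
  rw [v_B₀_conj_cornerUnipotent_sub_one_mulVec σ hvσ hu hk x, ht, one_mul]
  intro h
  exact sq_ne_exp_neg_one_mul_sq (x := Valued.v ((((k⁻¹ : GL (Fin 3) K) : Matrix (Fin 3) (Fin 3) K) *ᵥ x) 2)) (y := 1) one_ne_zero
    (by rwa [one_pow, mul_one])

/-- **General form**: the invariant values of the class of `n(t)` have valuations in `v(t)·(squares)`; two parameters `t, t′` with `v(t′) = exp(−1)·v(t)`, `v(t) ≠ 0`, give classes
whose invariant-value valuations are DISJOINT away from `0`. [cite: Rogawski1990, §3.9 p. 32] -/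
theorem v_B₀_conj_ne_of_v_eq_exp_neg_one_mul (hvσ : ∀ a, Valued.v (σ a) = Valued.v a) {t t' : K} (ht : Valued.v t ≠ 0) (htt' : Valued.v t' = WithZero.exp (-1 : ℤ) * Valued.v t)
    {u u' k k' : GL (Fin 3) K} (hu : (u : Matrix (Fin 3) (Fin 3) K) = !![1, 0, t; 0, 1, 0; 0, 0, 1]) (hu' : (u' : Matrix (Fin 3) (Fin 3) K) = !![1, 0, t'; 0, 1, 0; 0, 0, 1])
    (hk : k ∈ unitaryGroupOfForm σ ((StdForm.antidiagonal 3).over K)) (hk' : k' ∈ unitaryGroupOfForm σ ((StdForm.antidiagonal 3).over K)) (x x' : Fin 3 → K)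
    (hx : B₀ σ 3 x ((((k * u * k⁻¹ : GL (Fin 3) K) : Matrix (Fin 3) (Fin 3) K) - 1) *ᵥ x) ≠ 0) :
    Valued.v (B₀ σ 3 x ((((k * u * k⁻¹ : GL (Fin 3) K) : Matrix (Fin 3) (Fin 3) K) - 1) *ᵥ x)) ≠
      Valued.v (B₀ σ 3 x' ((((k' * u' * k'⁻¹ : GL (Fin 3) K) : Matrix (Fin 3) (Fin 3) K) - 1) *ᵥ x')) := by
  rw [v_B₀_conj_cornerUnipotent_sub_one_mulVec σ hvσ hu hk x, v_B₀_conj_cornerUnipotent_sub_one_mulVec σ hvσ hu' hk' x', htt']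
  set a := Valued.v ((((k⁻¹ : GL (Fin 3) K) : Matrix (Fin 3) (Fin 3) K) *ᵥ x) 2) with ha
  set b := Valued.v ((((k'⁻¹ : GL (Fin 3) K) : Matrix (Fin 3) (Fin 3) K) *ᵥ x') 2) with hb
  have ha0 : a ≠ 0 := by
    intro h0
    apply hx
    have := v_B₀_conj_cornerUnipotent_sub_one_mulVec σ hvσ hu hk x
    rw [← ha, h0, zero_pow two_ne_zero, mul_zero, map_eq_zero] at this
    exact this
  intro h
  -- `v t · a² = exp(−1) · v t · b²` ⇒ `a² = exp(−1) · b²`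
  have h' : a ^ 2 = WithZero.exp (-1 : ℤ) * b ^ 2 := by
    have := congrArg (fun z => (Valued.v t)⁻¹ * z) h
    beta_reduce at this
    rwa [← mul_assoc, inv_mul_cancel₀ ht, one_mul, mul_comm (WithZero.exp (-1 : ℤ)) (Valued.v t), mul_assoc, ← mul_assoc, inv_mul_cancel₀ ht, one_mul] at this
  have hb0 : b ≠ 0 := by
    intro h0
    rw [h0, zero_pow two_ne_zero, mul_zero] at h'
    exact ha0 (pow_eq_zero_iff two_ne_zero |>.1 h')
  exact sq_ne_exp_neg_one_mul_sq hb0 h'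

/-! ## §4 Transvection conjugates are square-zero -/

omit [Valued K ℤᵐ⁰] in
/-- **Conjugates of `n(t)` are square-zero**: `(k n(t) k⁻¹ − 1)² = 0` (so the residually-REGULAR piece misses the transvection classes and the identity). [cite: Rogawski1990, §3.9 p. 32] -/
theorem conj_cornerUnipotent_sub_one_mul_self {t : K} {u : GL (Fin 3) K} (hu : (u : Matrix (Fin 3) (Fin 3) K) = !![1, 0, t; 0, 1, 0; 0, 0, 1]) (k : GL (Fin 3) K) :
    (((k * u * k⁻¹ : GL (Fin 3) K) : Matrix (Fin 3) (Fin 3) K) - 1) * (((k * u * k⁻¹ : GL (Fin 3) K) : Matrix (Fin 3) (Fin 3) K) - 1) = 0 := by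
  rw [conj_sub_one_mul_self_eq_zero_iff, hu]
  ext i j
  fin_cases i <;> fin_cases j <;> simp [Matrix.mul_apply, Fin.sum_univ_three, Matrix.one_apply]

end Literature.NumberTheory.Automorphic.UnitaryGroup
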